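import Literature.NumberTheory.Automorphic.Liu2021.Def45AsPrinted
import Literature.NumberTheory.ComplexMultiplication.ReflexOfConjugateType
import Literature.NumberTheory.ComplexMultiplication.CMGaloisSubfield
import HarnessLib

/-!
# [Liu 2021] Definition 4.5 (1): `η_μ` does not see the complex conjugation of the presenting embedding

Y. Liu, *Fourier–Jacobi cycles and arithmetic relative trace formula*, Camb. J. Math. **9** (2021) 1–147 =
arXiv:2102.11518 [Liu2021], §4.1: Definition 4.3 (2) (TeX `FJcycle.tex` l. 1919: «`M'_μ ⊆ ℂ` the reflex field of
`(E, Φ_μ)`, with the induced CM type `Ψ_μ`»), Remark 4.4 (ll. 1930–1933: «`M'_{μ^c} = M'_μ`, and `Ψ_{μ^c}` is the opposite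
CM type of `Ψ_μ`»), Definition 4.5 (1) (ll. 1939–1942: «`η_μ := η'_μ ∘ Nm_{M_μ/M'_μ} : Res_{M_μ/ℚ} 𝔾_m → Res_{E/ℚ} 𝔾_m`»).

CONTEXT.  The tree's as-printed typing `Def45AsPrinted` (hcmisog-isog-1, p300837) DEFINES `η_μ` as
`Def45.eta φ ι hμ : M_μ →* E` in a PRESENTATION `(L, φ, ι)` of Liu's `M'_μ ⊆ ℂ`: `L` a CM field Galois over `ℚ` receiving
`E` along `φ : E →ₐ[ℚ] L`, read in `ℂ` through `ι : L →+* ℂ` (its READING I1-R1: «the presentation `(L, φ, ι)` is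
bookkeeping for `M'_μ ⊆ ℂ`; Liu's `η'_μ`, `η_μ`, `𝒜(μ)` do not depend on it … this file does not prove the independence»).
The TYPE of `Def45.eta φ ι hμ` does not mention `ι` (`M_μ = muAlgValueField E μ ⊆ ℂ` and `E` are intrinsic); only the
definition does (through `K*_ι = reflexField ℚ L (algValuedIn ι Φ_μ)`, `incl_ι : K*_ι → M_μ`, `k ↦ ι k`).

WHAT IS PROVED HERE (kernel; theorems only, nothing posited, no definition): the independence for the one change of
presentation the cells use — replacing `ι` by its complex conjugate `ῑ = conj ∘ ι` (the pin `ῑ₁ := (starRingEnd ℂ).comp ι₁`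
of package P2′, `Transposition/Item6PinReachAlong.lean` §4):

* `Def45.eta_conjugate` / `Def45.eta_starRingEnd_comp`: **`eta φ ῑ hμ = eta φ ι hμ`** as maps `M_μ →* E`.

The proof is CM-type bookkeeping at the archimedean places: (§1) reading a complex type through `ῑ` is reading its
conjugate through `ι` (`algValuedIn ῑ Θ = algValuedIn ι Θ̄`), so the presented reflex FIELD is the same
(`reflexField_algValuedIn_conjugate`, [Liu2021] Rem. 4.4 «`M'_{μ^c} = M'_μ`»; tree `reflexField_algValuedIn_bar`) and the
lifted reflex set is complemented (`reflexLift_algValuedIn_conjugate`); (§2) the CM type of `M_μ` induced from the reflex type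
presented through `ῑ` is the CONJUGATE of the one presented through `ι` (`inducedCMType_incl_conjugate` — Rem. 4.4 «`Ψ_{μ^c}` is
the opposite CM type» carried up to `M_μ`; the inclusion `incl_ῑ` is `incl_ι ∘ ρ` with `ρ = conjGal` central,
`conjGal_apply_mem`); (§3) the type norm of a conjugate type is the complex conjugate of the type norm (`finprod_mem_bar_apply`),
and `η_μ` is read in `ℂ` through `ῑ ∘ φ` resp. `ι ∘ φ` as those type norms (`Def45.apply_eta_eq_finprod`, tr-prover-1's (N)
`ReflexNormInducedType`); injectivity of `ῑ ∘ φ` concludes.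

USE (pub-hodgecm2 pinning, route (B) «e := conj ∘ ·» of the S2 END display, b28 §T20/§T21, hcomp-lead 2026-08-21T21:14Z):
hcmisog-isog-2's σ-parametric Core theorem `Model.exists_isogeny_isCMTypeRealisation_baseChange_of_det45`
(`Transposition/Item6PinMatchDef45.lean`, p301919) at `σ := (starRingEnd ℂ).comp ι₁` wants Def. 4.5 (2)'s first bullet with
`Def45.eta (AlgHom.id ℚ F) ((starRingEnd ℂ).comp ι₁) hμ`; by `eta_starRingEnd_comp (AlgHom.id ℚ F) ι₁ hμ` that hypothesis IS
the as-printed reading `hdet45` at `ι₁` (hcmisog-glue's display `Item6SupplyPinnedDef45.lean`, p305040) after one rewrite.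
Companion for the type-selection binder: tr-prover-2's `Transposition.isInverse_starRingEnd_comp_iff` (`Item2HoldsConj.lean`).
Nothing here concerns abelian varieties; HC_CM is NOT proved and nothing of the cells' displays is discharged by this file.

NOT HERE: independence of `η_μ` under an arbitrary change `ι ↦ ι ∘ γ`, `γ ∈ Gal(L/ℚ)` (then `K*_{ι∘γ} = γ⁻¹ K*_ι` is a
different subfield of `L` unless `γ` is central), or under change of `(L, φ)`.

Mathlib searched (pin): `MonoidHom.map_finprod_mem`, `finprod_mem_image`, `NumberField.ComplexEmbedding.involutive_conjugate`,
`conjugate_coe_eq`, `starRingEnd_self_apply` (used); Mathlib has no CM types / reflex fields / reflex norms.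

## References
* [Liu2021] Y. Liu, Camb. J. Math. 9 (2021) 1–147 = arXiv:2102.11518 — Def. 4.3 (2) (l. 1919), Remark 4.4 (ll. 1930–1933),
  Def. 4.5 (1) (ll. 1939–1942).
* [Shimura1998] G. Shimura, *Abelian Varieties with Complex Multiplication and Modular Functions*, Princeton 1998, §8.1
  Prop. 25, §8.3 Prop. 28–29, §18.5 (18.5b).
* [MilneCM2006] J. S. Milne, *Complex Multiplication* (course notes, 2006), Ch. I §1 (the conjugate CM type `ῑΦ`).

## Provenance
pub-hodgecm2 (COR-CM) TEAM hComp seat `hcomp-abcm-2` gen 2 («CM-type / signature bookkeeping at every archimedean place»),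
2026-08-21; consumer route (B) per HOME/INBOX l.5769 (b28 §T20), l.5787 (§T21), l.5789 (hcomp-lead).
-/

set_option autoImplicit false

noncomputable section

open NumberField NumberField.ComplexEmbedding
open Literature.AlgebraicGeometry.Motives (CMType)
open Literature.NumberTheory.ComplexMultiplication
open Literature.NumberTheory.ComplexMultiplication.CMTypeOps (bar mem_bar_iff conjugate_mem_iff_notMem)

namespace Literature.NumberTheory.Automorphic.Liu2021

namespace Def45

/-! ## §1 Reading a complex type through `ῑ = conj ∘ ι` (any CM field `L`, any `K`) -/

section Presentation

variable {L : Type} [Field L] [CharZero L] {K : Type} [Field K] [Algebra ℚ K]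

/-- `(conj ∘ ι) ∘ χ = conj ∘ (ι ∘ χ)`. [folklore] -/
private theorem conjugate_comp_coe (ι : L →+* ℂ) (χ : K →ₐ[ℚ] L) :
    (conjugate ι).comp (χ : K →+* L) = conjugate (ι.comp (χ : K →+* L)) :=
  RingHom.ext fun _ => rfl

/-- Reading `Θ` through `ῑ` is reading `Θ̄` through `ι`: `algValuedIn ῑ Θ = algValuedIn ι Θ̄`. [cite: Liu2021, Remark 4.4] -/
theorem algValuedIn_conjugate_eq_bar (ι : L →+* ℂ) (Θ : CMType K) :
    algValuedIn (conjugate ι) Θ.1 = algValuedIn ι (bar Θ).1 :=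
  Set.ext fun χ => by
    rw [mem_algValuedIn_iff, mem_algValuedIn_iff, conjugate_comp_coe, mem_bar_iff, conjugate_mem_iff_notMem]

/-- Hence `algValuedIn ῑ Θ = (algValuedIn ι Θ)ᶜ`. [cite: Liu2021, Remark 4.4] -/
theorem algValuedIn_conjugate_eq_compl (ι : L →+* ℂ) (Θ : CMType K) :
    algValuedIn (conjugate ι) Θ.1 = (algValuedIn ι Θ.1)ᶜ := by
  rw [algValuedIn_conjugate_eq_bar, algValuedIn_bar]

/-- **The presented reflex field is the same for `ι` and `ῑ`**: `reflexField ℚ L (algValuedIn ῑ Θ) = reflexField ℚ L (algValuedIn ι Θ)`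
(«`M'_{μ^c} = M'_μ`»). [cite: Liu2021, Remark 4.4] -/
theorem reflexField_algValuedIn_conjugate (ι : L →+* ℂ) (Θ : CMType K) :
    reflexField ℚ L (algValuedIn (conjugate ι) Θ.1) = reflexField ℚ L (algValuedIn ι Θ.1) := by
  rw [algValuedIn_conjugate_eq_bar, reflexField_algValuedIn_bar]

/-- The lifted reflex set through `ῑ` is the complement of the one through `ι`: `S*(Θ_ῑ) = S*(Θ_ι)ᶜ`.
[cite: Shimura1998, §8.3 Prop. 28] -/
theorem reflexLift_algValuedIn_conjugate (ι : L →+* ℂ) (Θ : CMType K) (φ : K →ₐ[ℚ] L) :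
    (reflexLift (algValuedIn (conjugate ι) Θ.1) φ : Set (L ≃ₐ[ℚ] L)) = (reflexLift (algValuedIn ι Θ.1) φ)ᶜ := by
  rw [algValuedIn_conjugate_eq_compl, reflexLift_compl]

end Presentation

/-! ## §2 The induced reflex type `Ψ̃_μ` presented through `ῑ` is the conjugate type -/

variable {E : Type} [Field E] [NumberField E] [IsCMField E]
variable {L : Type} [Field L] [NumberField L] [IsCMField L]

/-- `g` commutes with `ρ = conjGal` (centrality, pointwise). [folklore] -/
private theorem algEquiv_apply_conjGal (g : L ≃ₐ[ℚ] L) (x : L) :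
    g ((conjGal : L ≃ₐ[ℚ] L) x) = (conjGal : L ≃ₐ[ℚ] L) (g x) := by
  have h := congrArg (fun e : L ≃ₐ[ℚ] L => e x) (conjGal_central g)
  simpa only [AlgEquiv.mul_apply] using h.symm

variable [IsGalois ℚ L] (φ : E →ₐ[ℚ] L) (ι : L →+* ℂ)
variable {μ : IdeleClassGroup E →ₜ* Circle} (hμ : IdeleClassGroup.IsConjugateSymplectic E μ)

/-- The inclusion `M'_μ ⊆ M_μ` presented through `ῑ` at `ρ k` is the inclusion presented through `ι` at `k`:
`incl_ῑ (ρ k) = incl_ι (k)` in `M_μ` (both are the complex number `ι k`). [cite: Liu2021, §4.1 l. 1928] -/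
theorem incl_conjugate_apply_conjGal (k : reflexField ℚ L (algValuedIn ι hμ.cmType.1))
    (hk : (conjGal : L ≃ₐ[ℚ] L) (k : L) ∈ reflexField ℚ L (algValuedIn (conjugate ι) hμ.cmType.1)) :
    incl φ (conjugate ι) hμ ⟨(conjGal : L ≃ₐ[ℚ] L) (k : L), hk⟩ = incl φ ι hμ k := by
  apply Subtype.ext
  rw [coe_incl, coe_incl, conjugate_coe_eq, apply_conjGal_eq_conj, starRingEnd_self_apply]

/-- `ρ(K*_ι) ⊆ K*_ῑ` (the two presented reflex fields coincide and are `ρ`-stable). [folklore] -/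
private theorem conjGal_apply_mem_reflexField_conjugate (k : reflexField ℚ L (algValuedIn ι hμ.cmType.1)) :
    (conjGal : L ≃ₐ[ℚ] L) (k : L) ∈ reflexField ℚ L (algValuedIn (conjugate ι) hμ.cmType.1) := by
  rw [reflexField_algValuedIn_conjugate]
  exact conjGal_apply_mem _ k.2

/-- **`Ψ̃_μ` presented through `ῑ` is the conjugate of `Ψ̃_μ` presented through `ι`**: the CM type of `M_μ` induced along
`incl_ῑ : K*_ῑ → M_μ` from the reflex CM type read through `ῑ` is `bar` of the one obtained through `ι`
([Liu2021] Rem. 4.4 «`Ψ_{μ^c}` is the opposite CM type of `Ψ_μ`», transported to `M_μ`). [cite: Liu2021, Remark 4.4] -/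
theorem inducedCMType_incl_conjugate :
    inducedCMType (incl φ (conjugate ι) hμ) (reflexCMType (conjugate ι) hμ.cmType φ) =
      bar (inducedCMType (incl φ ι hμ) (reflexCMType ι hμ.cmType φ)) := by
  apply Subtype.ext
  ext θ
  rw [mem_inducedCMType_iff, mem_bar_iff, mem_inducedCMType_iff]
  -- present `θ ∘ incl_ῑ : K*_ῑ → ℂ` as `ῑ ∘ (g|_{K*_ῑ})`
  obtain ⟨ψ, hψ⟩ := exists_algHom_comp_eq_of_normal
    (reflexField ℚ L (algValuedIn (conjugate ι) hμ.cmType.1)).val (conjugate ι) (θ.comp (incl φ (conjugate ι) hμ))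
  obtain ⟨g, rfl⟩ := exists_algEquiv_smul_eq (reflexField ℚ L (algValuedIn (conjugate ι) hμ.cmType.1)).val ψ
  -- then `θ ∘ incl_ι : K*_ι → ℂ` is `ι ∘ (g|_{K*_ι})` for the SAME `g`
  have hθ : θ.comp (incl φ ι hμ) =
      ι.comp ((g • (reflexField ℚ L (algValuedIn ι hμ.cmType.1)).val :
        reflexField ℚ L (algValuedIn ι hμ.cmType.1) →ₐ[ℚ] L) : _ →+* L) := by
    refine RingHom.ext fun k => ?_
    have hk := conjGal_apply_mem_reflexField_conjugate ι hμ k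
    have h := RingHom.congr_fun hψ ⟨(conjGal : L ≃ₐ[ℚ] L) (k : L), hk⟩
    simp only [RingHom.coe_comp, Function.comp_apply, AlgHom.coe_toRingHom, algEquiv_smul_apply,
      IntermediateField.coe_val] at h ⊢
    rw [incl_conjugate_apply_conjGal] at h
    rw [← h, algEquiv_apply_conjGal, conjugate_coe_eq, apply_conjGal_eq_conj, starRingEnd_self_apply]
  rw [← hψ, hθ, comp_smul_val_mem_reflexCMType_iff, comp_smul_val_mem_reflexCMType_iff,
    reflexLift_algValuedIn_conjugate, Set.mem_compl_iff]

/-! ## §3 `η_μ` through `ῑ` equals `η_μ` through `ι` -/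

/-- The type norm of the conjugate type is the complex conjugate of the type norm. [folklore] -/
private theorem finprod_mem_bar_apply {M : Type} [Field M] [NumberField M] (Θ : CMType M) (x : M) :
    ∏ᶠ θ ∈ (bar Θ).1, θ x = starRingEnd ℂ (∏ᶠ θ ∈ Θ.1, θ x) := by
  have himg : (bar Θ).1 = conjugate '' Θ.1 := by
    ext θ
    rw [mem_bar_iff, Set.mem_image]
    constructor
    · intro h
      exact ⟨conjugate θ, (conjugate_mem_iff_notMem Θ θ).mpr h, involutive_conjugate M θ⟩
    · rintro ⟨θ', hθ', rfl⟩
      exact (Θ.2 θ').mp hθ'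
  have hmap := MonoidHom.map_finprod_mem (fun θ : M →+* ℂ => θ x) (starRingEnd ℂ : ℂ →* ℂ) (Set.toFinite Θ.1)
  simp only [MonoidHom.coe_coe] at hmap
  rw [himg, finprod_mem_image (involutive_conjugate M).injective.injOn]
  calc ∏ᶠ θ ∈ Θ.1, (conjugate θ) x = ∏ᶠ θ ∈ Θ.1, starRingEnd ℂ (θ x) :=
        finprod_mem_congr rfl fun θ _ => conjugate_coe_eq θ x
    _ = starRingEnd ℂ (∏ᶠ θ ∈ Θ.1, θ x) := hmap.symm

/-- **`η_μ` presented through `ῑ = conj ∘ ι` is `η_μ` presented through `ι`** — the conj case of READING I1-R1 of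
`Def45AsPrinted` («Liu's `η'_μ`, `η_μ`, `𝒜(μ)` do not depend on the presentation»): as maps `M_μ →* E`,
`eta φ ῑ hμ = eta φ ι hμ`.  Proof: read both in `ℂ` through `ῑ ∘ φ` (`apply_eta_eq_finprod`); the induced type through
`ῑ` is the conjugate type (`inducedCMType_incl_conjugate`), whose type norm is the conjugate (`finprod_mem_bar_apply`).
[cite: Liu2021, Def. 4.5 (1) (l. 1941) and Remark 4.4] -/
theorem eta_conjugate : eta φ (conjugate ι) hμ = eta φ ι hμ := by
  haveI := hμ.numberField_muAlgValueField
  refine MonoidHom.ext fun x => ?_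
  apply (φ : E →+* L).injective
  apply (conjugate ι).injective
  change (conjugate ι) (φ (eta φ (conjugate ι) hμ x)) = (conjugate ι) (φ (eta φ ι hμ x))
  rw [apply_eta_eq_finprod φ (conjugate ι) hμ x, inducedCMType_incl_conjugate, finprod_mem_bar_apply,
    conjugate_coe_eq, apply_eta_eq_finprod φ ι hμ x]

/-- Pointwise form. [cite: Liu2021, Def. 4.5 (1) (l. 1941)] -/
theorem eta_conjugate_apply (x : IdeleClassGroup.muAlgValueField E μ) :
    eta φ (conjugate ι) hμ x = eta φ ι hμ x := by
  rw [eta_conjugate]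

/-- The `starRingEnd` spelling (`ῑ₁ := (starRingEnd ℂ).comp ι₁` of the cells' pinning files): `eta φ (conj ∘ ι) hμ = eta φ ι hμ`.
[cite: Liu2021, Def. 4.5 (1) (l. 1941)] -/
theorem eta_starRingEnd_comp : eta φ ((starRingEnd ℂ).comp ι) hμ = eta φ ι hμ :=
  eta_conjugate φ ι hμ

/-- Pointwise `starRingEnd` spelling. [cite: Liu2021, Def. 4.5 (1) (l. 1941)] -/
theorem eta_starRingEnd_comp_apply (x : IdeleClassGroup.muAlgValueField E μ) :
    eta φ ((starRingEnd ℂ).comp ι) hμ x = eta φ ι hμ x := by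
  rw [eta_starRingEnd_comp]

end Def45

end Literature.NumberTheory.Automorphic.Liu2021

end
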